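import Summits.MatrixMultiplication.MatrixMultiplication.Theorems.OutsiderSandwichSliceRank
import HarnessLib

/-!
# The amortised exchange table `a(N, m)` — typed, with its first row

Route `OutsiderSandwich` (decomposition cell `decomp-mm`, lens 4 «minimal counterexample /
extremal reduction», gen 28), support for the aside leaf `BlockOneIsMM`
(stmt-MatrixMultiplication-27147).

The AMORTISED EXCHANGE NUMBER `a(N, m) := min {B | ⟨B⟩ ⊠ C₁^{⊠N} ⊵ ⟨m⟩ ⊠ ⟨2,2,2⟩^{⊠N}}` extends
the exchange number `r(N) = a(N, 1)` (`amortisedNumber_one_right`).  This file types it and collects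
what gen 28 proved about it, so that the census asks become closed Lean statements:

* well-defined, monotone, `a(N, m) ≤ m·r(N)` (`amortisedNumber_le_mul_exchangeNumber`),
  subadditive in `m` (`amortisedNumber_add_le`);
* FLOORS: `a(N, m) ≥ m + 1` (no tight exchange) and the slice-rank floor
  `m·4^{n+1} + a·2^n ≤ a·4^{n+1}` (`amortisedNumber_floor`), at level one `4m ≤ 3·a(1, m)`;
* CEILING at level one `2·a(1, m) ≤ 3m + 1` (direct sums of the `(3 → 2)` certificate);
* VALUES `a(1,1) = 2`, `a(1,2) = 3`, `a(1,4) = 6`, and `a(1,3) ∈ {4, 5}`;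
* the EXPONENT: every entry bounds `θ⋆ ≤ log₂(a(N,m)/m)/N`
  (`exchangeExponent_le_of_amortisedNumber`).

ASKS (typed here, value-free): `amortisedNumber 1 3 = 4` (`⟨4⟩ ⊠ C₁ ⊵ ⟨3⟩ ⊠ ⟨2,2,2⟩`?) and
`amortisedNumber 2 2 = 3` (`⟨3⟩ ⊠ C₁^{⊠2} ⊵ ⟨2⟩ ⊠ ⟨2,2,2⟩^{⊠2}`?, which would give
`θ⋆ ≤ log₂(3/2)/2 = 0.2925 < 0.37295`).

## References
* D. Coppersmith, S. Winograd, *Matrix multiplication via arithmetic progressions*,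
  J. Symbolic Comput. 9 (1990) 251–280, §7. [CoppersmithWinograd1990]
* P. Bürgisser, M. Clausen, M. A. Shokrollahi, *Algebraic Complexity Theory*, Springer 1997,
  (14.21), §14.4. [BurgisserClausenShokrollahi1997]
-/

noncomputable section

open scoped BigOperators

set_option linter.dupNamespace false
set_option autoImplicit false

namespace Summit.MatrixMultiplication.MatrixMultiplication.Theorems.OutsiderSandwichAmortisedTable

open Literature.Computability.AlgebraicComplexity
open Summit.MatrixMultiplication.MatrixMultiplication.Theorems.OutsiderSandwichCoupling (coupling₁)
open Summit.MatrixMultiplication.MatrixMultiplication.Theorems.OutsiderSandwichExchangeRate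
  (Helped helped_iff_le helped_one_two helped_pow_two_pow)
open Summit.MatrixMultiplication.MatrixMultiplication.Theorems.OutsiderSandwichExchangeExponent
  (exchangeExponent exchangeNumber helped_exchangeNumber exchangeNumber_le exchangeNumber_one)
open Summit.MatrixMultiplication.MatrixMultiplication.Theorems.OutsiderSandwichAmortised
  (amortised_iff_le restrictsTo_unitOne_iff_helped)
open Summit.MatrixMultiplication.MatrixMultiplication.Theorems.OutsiderSandwichSliceRank
  (amortised_floor level_one_floor amortised_add)

/-! ## 1. Amortised certificates -/

/-- **`Amortised N B m`** (problem-side definition): `⟨B⟩ ⊠ C₁^{⊠N} ⊵ ⟨m⟩ ⊠ ⟨2,2,2⟩^{⊠N}` —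
`B` coupled blocks give `m` independent `2^N × 2^N` matrix products. -/
def Amortised (N B m : ℕ) : Prop :=
  TensorRestrictsTo (kroneckerTensor (unitTensor ℂ B) (kroneckerPow coupling₁ N))
    (kroneckerTensor (unitTensor ℂ m) (kroneckerPow (matMulTensor ℂ 2 2 2) N))

/-- `Amortised` as the inequality `m·[M]^N ≤ B·[C₁]^N` in `T(ℂ)`.
[cite: BurgisserClausenShokrollahi1997, (14.21)] -/
theorem amortised_iff (N B m : ℕ) :
    Amortised N B m ↔ (m : TensorClass ℂ) * TensorClass.mk (matMulTensor ℂ 2 2 2) ^ N ≤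
      (B : TensorClass ℂ) * TensorClass.mk coupling₁ ^ N :=
  amortised_iff_le N B m

/-- Monotone in the number of copies. [folklore] -/
theorem Amortised.mono {N B B' m : ℕ} (h : Amortised N B m) (hB : B ≤ B') : Amortised N B' m := by
  rw [amortised_iff] at h ⊢
  exact h.trans (TensorClass.mul_le_mul (TensorClass.natCast_le_natCast_iff.2 hB) le_rfl)

/-- Antitone in the number of products. [folklore] -/
theorem Amortised.anti {N B m m' : ℕ} (h : Amortised N B m) (hm : m' ≤ m) : Amortised N B m' := by
  rw [amortised_iff] at h ⊢
  exact (TensorClass.mul_le_mul (TensorClass.natCast_le_natCast_iff.2 hm) le_rfl).trans h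

/-- Multiplicity one is `Helped`. [cite: CoppersmithWinograd1990, §7] -/
theorem amortised_one_iff (N B : ℕ) : Amortised N B 1 ↔ Helped N B :=
  restrictsTo_unitOne_iff_helped N B

/-- Certificates add. [cite: BurgisserClausenShokrollahi1997, (14.21)] -/
theorem Amortised.add {N B B' m m' : ℕ} (h : Amortised N B m) (h' : Amortised N B' m') :
    Amortised N (B + B') (m + m') :=
  amortised_add h h'

/-- Zero products need nothing. [folklore] -/
theorem amortised_zero (N B : ℕ) : Amortised N B 0 := by
  rw [amortised_iff, Nat.cast_zero, zero_mul]
  exact TensorClass.zero_le _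

/-- Certificates scale: `(N, B, m) ⟹ (N, kB, km)`. [cite: BurgisserClausenShokrollahi1997, (14.21)] -/
theorem Amortised.smul {N B m : ℕ} (h : Amortised N B m) (k : ℕ) : Amortised N (k * B) (k * m) := by
  induction k with
  | zero => rw [zero_mul, zero_mul]; exact amortised_zero N 0
  | succ k ih =>
    rw [Nat.succ_mul, Nat.succ_mul]
    exact ih.add h

/-- Existence: `m·2^N` copies give `m` products (`Helped N 2^N`, added `m` times). [folklore] -/
theorem amortised_mul_two_pow (N m : ℕ) : Amortised N (m * 2 ^ N) m := by
  have h := ((amortised_one_iff N (2 ^ N)).2 (helped_pow_two_pow N)).smul m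
  rwa [mul_one] at h

/-! ## 2. The amortised exchange number -/

/-- **The amortised exchange number** `a(N, m) := min {B | Amortised N B m}`
(problem-side definition; `a(N, 1) = r(N)`). -/
def amortisedNumber (N m : ℕ) : ℕ :=
  sInf {B : ℕ | Amortised N B m}

/-- `a(N, m)` copies suffice. [folklore] -/
theorem amortised_amortisedNumber (N m : ℕ) : Amortised N (amortisedNumber N m) m :=
  Nat.sInf_mem (s := {B : ℕ | Amortised N B m}) ⟨m * 2 ^ N, amortised_mul_two_pow N m⟩

/-- Minimality. [folklore] -/
theorem amortisedNumber_le {N B m : ℕ} (h : Amortised N B m) : amortisedNumber N m ≤ B :=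
  Nat.sInf_le h

/-- `Amortised N B m ⟺ a(N, m) ≤ B`. [folklore] -/
theorem amortised_iff_amortisedNumber_le {N B m : ℕ} : Amortised N B m ↔ amortisedNumber N m ≤ B :=
  ⟨amortisedNumber_le, fun h => (amortised_amortisedNumber N m).mono h⟩

/-- `a(N, 1) = r(N)`. [cite: CoppersmithWinograd1990, §7] -/
theorem amortisedNumber_one_right (N : ℕ) : amortisedNumber N 1 = exchangeNumber N := by
  apply le_antisymm
  · exact amortisedNumber_le ((amortised_one_iff N _).2 (helped_exchangeNumber N))
  · exact exchangeNumber_le ((amortised_one_iff N _).1 (amortised_amortisedNumber N 1))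

/-- Subadditivity in `m`. [cite: BurgisserClausenShokrollahi1997, (14.21)] -/
theorem amortisedNumber_add_le (N m m' : ℕ) :
    amortisedNumber N (m + m') ≤ amortisedNumber N m + amortisedNumber N m' :=
  amortisedNumber_le ((amortised_amortisedNumber N m).add (amortised_amortisedNumber N m'))

/-- `a(N, m) ≤ m·r(N)`. [cite: CoppersmithWinograd1990, §7] -/
theorem amortisedNumber_le_mul_exchangeNumber (N m : ℕ) :
    amortisedNumber N m ≤ m * exchangeNumber N := by
  have h := ((amortised_one_iff N _).2 (helped_exchangeNumber N)).smul m
  rw [mul_one] at h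
  exact amortisedNumber_le h

/-! ## 3. Floors -/

/-- **No tight exchange**: `a(N, m) ≥ m + 1` for `N, m ≥ 1`. [cite: CoppersmithWinograd1990, §7] -/
theorem succ_le_amortisedNumber {N m : ℕ} (hN : 1 ≤ N) (hm : 1 ≤ m) :
    m + 1 ≤ amortisedNumber N m :=
  OutsiderSandwichNoTightExchange.succ_le_of_amortised hN hm (amortised_amortisedNumber N m)

/-- **Slice-rank floor**: `m·4^{n+1} + a·2^n ≤ a·4^{n+1}` for `a = a(n+1, m)`.
[cite: BurgisserClausenShokrollahi1997, §14.4] -/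
theorem amortisedNumber_floor (n m : ℕ) :
    m * 4 ^ (n + 1) + amortisedNumber (n + 1) m * 2 ^ n ≤ amortisedNumber (n + 1) m * 4 ^ (n + 1) :=
  amortised_floor (amortised_amortisedNumber (n + 1) m)

/-- **Level one, floor**: `4m ≤ 3·a(1, m)`. [cite: CoppersmithWinograd1990, §7] -/
theorem level_one_lower (m : ℕ) : 4 * m ≤ 3 * amortisedNumber 1 m :=
  level_one_floor (amortised_amortisedNumber 1 m)

/-! ## 4. Level one: ceiling and values -/

/-- `(1; 3 → 2)`: three copies, two products. [cite: CoppersmithWinograd1990, §7] -/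
theorem amortised_one_three_two : Amortised 1 3 2 :=
  OutsiderSandwichYield.unitThree_coupling₁_restrictsTo_unitTwo_matMul

/-- Even multiplicity: `a(1, 2k) ≤ 3k`. [cite: CoppersmithWinograd1990, §7] -/
theorem amortised_one_even (k : ℕ) : Amortised 1 (3 * k) (2 * k) := by
  have h := amortised_one_three_two.smul k
  rwa [mul_comm k 3, mul_comm k 2] at h

/-- Odd multiplicity: `a(1, 2k+1) ≤ 3k + 2`. [cite: CoppersmithWinograd1990, §7] -/
theorem amortised_one_odd (k : ℕ) : Amortised 1 (3 * k + 2) (2 * k + 1) :=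
  (amortised_one_even k).add ((amortised_one_iff 1 2).2 helped_one_two)

/-- **Level one, ceiling**: `2·a(1, m) ≤ 3m + 1`. [cite: CoppersmithWinograd1990, §7] -/
theorem level_one_upper (m : ℕ) : 2 * amortisedNumber 1 m ≤ 3 * m + 1 := by
  obtain ⟨k, rfl | rfl⟩ := Nat.even_or_odd' m
  · have := amortisedNumber_le (amortised_one_even k); omega
  · have := amortisedNumber_le (amortised_one_odd k); omega

/-- `a(1, 1) = 2`. [cite: CoppersmithWinograd1990, §7] -/
theorem amortisedNumber_one_one : amortisedNumber 1 1 = 2 := by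
  rw [amortisedNumber_one_right, exchangeNumber_one]

/-- **`a(1, 2) = 3`**. [cite: CoppersmithWinograd1990, §7] -/
theorem amortisedNumber_one_two : amortisedNumber 1 2 = 3 := by
  have h1 := level_one_lower 2
  have h2 := level_one_upper 2
  omega

/-- **`a(1, 4) = 6`**. [cite: CoppersmithWinograd1990, §7] -/
theorem amortisedNumber_one_four : amortisedNumber 1 4 = 6 := by
  have h1 := level_one_lower 4
  have h2 := level_one_upper 4
  omega

/-- **`a(1, 3) ∈ {4, 5}`** — the first open entry. [cite: CoppersmithWinograd1990, §7] -/
theorem amortisedNumber_one_three : amortisedNumber 1 3 = 4 ∨ amortisedNumber 1 3 = 5 := by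
  have h1 := level_one_lower 3
  have h2 := level_one_upper 3
  omega

/-- The first open entry as a restriction statement: `a(1,3) = 4 ⟺ ⟨4⟩ ⊠ C₁ ⊵ ⟨3⟩ ⊠ ⟨2,2,2⟩`.
[cite: CoppersmithWinograd1990, §7] -/
theorem amortisedNumber_one_three_eq_four_iff : amortisedNumber 1 3 = 4 ↔ Amortised 1 4 3 := by
  rw [amortised_iff_amortisedNumber_le]
  have := amortisedNumber_one_three
  omega

/-! ## 5. The exponent -/

/-- **Every entry bounds the exchange exponent**: `θ⋆ ≤ log₂(a(N, m)/m)/N` (`N, m ≥ 1`).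
[cite: Strassen1988, Thm. 3.8] -/
theorem exchangeExponent_le_of_amortisedNumber {N m : ℕ} (hN : 0 < N) (hm : 0 < m) :
    exchangeExponent ≤ Real.logb 2 ((amortisedNumber N m : ℝ) / m) / N :=
  OutsiderSandwichAmortised.exchangeExponent_le_of_amortised_restrictsTo hN hm
    (amortised_amortisedNumber N m)

/-- The level-two ask in exponent form: `a(2, 2) = 3` would give `θ⋆ ≤ log₂(3/2)/2 < 0.2925`,
below the tree's `0.37295`. [cite: Strassen1988, Thm. 3.8] -/
theorem exchangeExponent_le_of_two_two (h : Amortised 2 3 2) :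
    exchangeExponent ≤ Real.logb 2 ((3 : ℝ) / 2) / 2 := by
  have h3 : amortisedNumber 2 2 ≤ 3 := amortisedNumber_le h
  have h3' : 3 ≤ amortisedNumber 2 2 := succ_le_amortisedNumber (by norm_num) (by norm_num)
  have heq : amortisedNumber 2 2 = 3 := le_antisymm h3 h3'
  have := exchangeExponent_le_of_amortisedNumber (N := 2) (m := 2) (by norm_num) (by norm_num)
  rw [heq] at this
  norm_num at this ⊢
  exact this

end Summit.MatrixMultiplication.MatrixMultiplication.Theorems.OutsiderSandwichAmortisedTable
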